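import Literature.Computability.QuantumComplexity.HadamardGadgetHopSimulation
import Literature.Computability.QuantumComplexity.PostBQPToPostIQP
import HarnessLib

/-!
# The Hadamard-gadget family: post-selected statistics are transferred (BJS Theorem 1)

Topic `Literature/Computability/QuantumComplexity`; fourth file of the `HGadget.Hop` line of the discharge
of the named fact `PostBQPWith_subset_PostIQPWith` (`PostBQPToPostIQP.lean`; M. J. Bremner, R. Jozsa,
D. J. Shepherd, Proc. R. Soc. A 467 (2011) = arXiv:1005.1407, Thm. 1 and its proof, p. 7), after
`HadamardGadgetStates.lean`, `HadamardGadgetCompiler.lean`, `HadamardGadgetHopSimulation.lean` (named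
`Hop…` to stay clear of the other line's `HadamardGadgetFamily.lean`, which defines `HGadget.gadgetFamily`
from the table-based rewriting; the present `HGadget.Hop.gadgetFamily` is the family of the hop
compiler, the one the uniformity machine `HadamardGadgetAsm/Prog/Loop/Phases/Machine.lean` prints).

* `HGadget.Hop.gadgetFamily F : PostIQPFamily` — the compiled family of a Clifford+T family `F` (its
  diagonal part `gadgetCircuit (F.circ n)`, its ancilla count and post-selection block);
* the Born rule for the compiled family: the output state is a unit vector (`normSq_gadgetState`),
  event probabilities are sums of squared amplitudes (`toReal_bornPMF_map_ofFn`), and the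
  post-selection / joint acceptance events of `PostIQPFamily` are the events `PostZero` (and
  "output wire `n` reads `1`") of the simulation theorem (`postselectProbOn_gadgetFamily`,
  `jointAcceptProbOn_gadgetFamily`);
* **`HGadget.Hop.postselectProbOn_eq` / `HGadget.Hop.jointAcceptProbOn_eq`**: for an oracle-free family and
  an input on which the given family post-selects with positive probability,
  `Pr'[post] = 2^{-N s_f} · Pr[post]` and `Pr'[acc ∧ post] = 2^{-N s_f} · Pr[acc ∧ post]`;
* **`HGadget.Hop.postDecides_gadgetFamily`**: hence the compiled family decides, with the same tolerance
  `ε`, every language the given family decides in the sense of `PostBQPWith ε` — BJS: "with the same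
  output conditional probabilities as originally";
* `PostBQPWith_subset_PostIQPWith_of_uniform`: the named fact follows from the uniformity of the
  compiled family (the subject of the remaining files).

## References

* M. J. Bremner, R. Jozsa, D. J. Shepherd, Proc. R. Soc. A 467 (2011) 459–472, arXiv:1005.1407,
  Thm. 1 (proof, p. 7), Def. 3 (post-selected classes), §2.4 eq. (1).
* M. A. Nielsen, I. L. Chuang, *Quantum Computation and Quantum Information*, CUP 2010, §2.2.5
  (Born rule).
-/

noncomputable section

namespace Literature.Computability.QuantumComplexity

open Matrix Cryptography Finset
open Literature.Barriers.QuantumAdvantage (norm_circPhase)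

namespace HGadget.Hop

/-! ### The compiled family -/

/-- **The compiled post-selected IQP family** of a Clifford+T family `F`: on inputs of length `n`,
the compiled diagonal part of `F.circ n`, its ancilla wires, and the post-selection block
`n + 1, …, n + postLen`. [cite: BremnerJozsaShepherdPRSA2011, Thm. 1 (proof)] -/
def gadgetFamily (F : QCircuitFamily cliffordT) : PostIQPFamily where
  ancillas n := ancillas n (F.ancillas n) (F.circ n)
  diag n := gadgetCircuit (F.circ n)
  postLen n := postLen n (F.ancillas n) (F.circ n)

/-! ### The output state is a unit vector -/

/-- A diagonal of unit-modulus phases preserves the norm. [folklore] -/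
theorem normSq_diagonal_mulVec {W : ℕ} {d : QReg W → ℂ} (hd : ∀ z, ‖d z‖ = 1) (v : QReg W → ℂ) :
    normSq (diagonal d *ᵥ v) = normSq v := by
  unfold normSq
  refine Finset.sum_congr rfl fun z _ => ?_
  rw [mulVec_diagonal, norm_mul, hd z, one_mul]

variable {n m : ℕ} (C : QCircuit cliffordT (n + m))

/-- **The output state of the compiled IQP circuit is a unit vector** (`H^{⊗W}` is unitary and the
diagonal part has unit-modulus phases). [cite: NielsenChuang2010, §2.2.5] -/
theorem normSq_gadgetState (x : QReg n) : normSq (gadgetState C x) = 1 := by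
  rw [gadgetState_eq, normSq_mulVec_of_mem_unitaryGroup (hGateAll_mem_unitaryGroup_holds _),
    normSq_diagonal_mulVec (norm_circPhase _), initState,
    normSq_mulVec_of_mem_unitaryGroup (hGateAll_mem_unitaryGroup_holds _), normSq_basisState]

/-! ### Born probabilities of events of measured strings -/

/-- **Born rule for events of measured strings**: for a unit vector `v`, the probability that the
measured string (all wires, read as a list) lies in `E` is the sum of `|v(z)|²` over the labels read
into `E`. [cite: NielsenChuang2010, §2.2.5] -/
theorem toReal_bornPMF_map_ofFn {W : ℕ} {v : QReg W → ℂ} (hv : normSq v = 1) (E : Set (List Bool))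
    [DecidablePred (· ∈ E)] :
    (((bornPMF v).map List.ofFn).toOuterMeasure E).toReal = ∑ z : QReg W, if List.ofFn z ∈ E then ‖v z‖ ^ 2 else 0 := by
  have happ : ∀ z, bornPMF v z = ENNReal.ofReal (‖v z‖ ^ 2) := bornPMF_apply_of_sum_eq_one hv
  rw [PMF.toOuterMeasure_map_apply, PMF.toOuterMeasure_apply, tsum_fintype, ENNReal.toReal_sum (fun z _ => ?_)]
  · refine Finset.sum_congr rfl fun z _ => ?_
    simp only [Set.indicator, Set.mem_preimage]
    split_ifs
    · rw [happ, ENNReal.toReal_ofReal (sq_nonneg _)]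
    · rfl
  · simp only [Set.indicator]
    split_ifs
    · rw [happ]; exact ENNReal.ofReal_ne_top
    · exact ENNReal.zero_ne_top

/-- Reading position `i` of the measured string. [folklore] -/
theorem getD_ofFn {W : ℕ} (z : QReg W) (i : ℕ) :
    (List.ofFn z).getD i false = if h : i < W then z ⟨i, h⟩ else false := by
  by_cases h : i < W
  · rw [dif_pos h, List.getD_eq_getElem _ _ (by simpa using h), List.getElem_ofFn]
  · rw [dif_neg h, List.getD_eq_default _ _ (by simpa using h)]

/-- **The post-selection event of `PostIQPFamily` is `PostZero`** (for `N ≥ 2`, when the whole block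
`n + 1, …, n + postLen` consists of wires of the circuit). [cite: BremnerJozsaShepherdPRSA2011, Def. 3] -/
theorem ofFn_mem_iqpPostselectStrings_iff (hN : 2 ≤ n + m) (z : QReg (width C)) :
    List.ofFn z ∈ iqpPostselectStrings n (postLen n m C) ↔ PostZero C z := by
  have hpl := n_add_postLen C
  have hW : n + postLen n m C < width C := by rw [hpl, width, width_eq]; omega
  simp only [iqpPostselectStrings, Set.mem_setOf_eq, getD_ofFn, PostZero]
  constructor
  · rintro ⟨h1, h2⟩ w hw
    rcases hw with hw | ⟨hw1, hw2⟩
    · have := h1 w hw; rwa [dif_pos w.2] at this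
    · have := h2 ((w : ℕ) - (n + 1)) (by omega)
      rwa [dif_pos (by omega), show (⟨n + 1 + ((w : ℕ) - (n + 1)), _⟩ : Fin (width C)) = w from Fin.ext (by simp; omega)] at this
  · intro h
    refine ⟨fun i hi => ?_, fun j hj => ?_⟩
    · rw [dif_pos (by omega)]; exact h _ (Or.inl hi)
    · rw [dif_pos (by omega)]; exact h _ (Or.inr ⟨by simp, by simp; omega⟩)

/-- The acceptance event is "the output wire `n` reads `1`". [cite: BremnerJozsaShepherdPRSA2011, Def. 3] -/
theorem ofFn_mem_iqpAcceptStrings_iff (z : QReg (width C)) :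
    List.ofFn z ∈ iqpAcceptStrings n ↔ z (outWire C) = true := by
  simp only [iqpAcceptStrings, Set.mem_setOf_eq, getD_ofFn]
  rw [dif_pos (show n < width C from (outWire C).2)]
  rfl

/-! ### The statistics of the compiled family -/

/-- The post-selection probability of the compiled family as a Born sum over `PostZero`.
[cite: BremnerJozsaShepherdPRSA2011, §2.4 eq. (1)] -/
theorem postselectProbOn_gadgetFamily (F : QCircuitFamily cliffordT) (x : List Bool)
    (hN : 2 ≤ x.length + F.ancillas x.length) :
    (gadgetFamily F).postselectProbOn x =
      ∑ z : QReg (width (F.circ x.length)), if PostZero (F.circ x.length) z then ‖gadgetState (F.circ x.length) x.get z‖ ^ 2 else 0 := by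
  classical
  rw [PostIQPFamily.postselectProbOn]
  change ((((bornPMF (gadgetState (F.circ x.length) x.get)).map List.ofFn).toOuterMeasure
    (iqpPostselectStrings x.length (postLen x.length (F.ancillas x.length) (F.circ x.length)))).toReal) = _
  rw [toReal_bornPMF_map_ofFn (normSq_gadgetState _ _)]
  refine Finset.sum_congr rfl fun z _ => ?_
  simp only [ofFn_mem_iqpPostselectStrings_iff (F.circ x.length) hN]

/-- The joint acceptance probability of the compiled family as a Born sum over `PostZero ∧ out = 1`.
[cite: BremnerJozsaShepherdPRSA2011, §2.4 eq. (1)] -/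
theorem jointAcceptProbOn_gadgetFamily (F : QCircuitFamily cliffordT) (x : List Bool)
    (hN : 2 ≤ x.length + F.ancillas x.length) :
    (gadgetFamily F).jointAcceptProbOn x =
      ∑ z : QReg (width (F.circ x.length)), if (PostZero (F.circ x.length) z ∧ z (outWire (F.circ x.length)) = true)
        then ‖gadgetState (F.circ x.length) x.get z‖ ^ 2 else 0 := by
  classical
  rw [PostIQPFamily.jointAcceptProbOn]
  change ((((bornPMF (gadgetState (F.circ x.length) x.get)).map List.ofFn).toOuterMeasure
    (iqpAcceptStrings x.length ∩ iqpPostselectStrings x.length (postLen x.length (F.ancillas x.length) (F.circ x.length)))).toReal) = _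
  rw [toReal_bornPMF_map_ofFn (normSq_gadgetState _ _)]
  refine Finset.sum_congr rfl fun z _ => ?_
  simp only [Set.mem_inter_iff, ofFn_mem_iqpPostselectStrings_iff (F.circ x.length) hN, ofFn_mem_iqpAcceptStrings_iff,
    and_comm]

/-! ### The statistics of the given family -/

/-- The post-selection probability of a Clifford+T family as a Born sum over "wire `1` reads `1`".
[cite: Aaronson2005, Def. 1] -/
theorem postselectProbOn_eq_sum (F : QCircuitFamily cliffordT) (x : List Bool) (hN : 2 ≤ x.length + F.ancillas x.length) :
    F.postselectProbOn 0 x = ∑ y : QReg (x.length + F.ancillas x.length),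
      if y ⟨1, hN⟩ = true then ‖((F.circ x.length).mat *ᵥ basisState (padInput x.get (F.ancillas x.length))) y‖ ^ 2 else 0 := by
  classical
  rw [QCircuitFamily.postselectProbOn, QCircuit.postselectProb, QCircuit.probEvent, Finset.sum_filter]
  refine Finset.sum_congr rfl fun y _ => ?_
  have h : y ∈ QCircuit.postselectEvent (x.length + F.ancillas x.length) ↔ y ⟨1, hN⟩ = true :=
    ⟨fun ⟨_, hy⟩ => hy, fun hy => ⟨hN, hy⟩⟩
  simp only [h]
  rfl

/-- The joint acceptance probability of a Clifford+T family as a Born sum over "wires `0`, `1` read `1`".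
[cite: Aaronson2005, Def. 1] -/
theorem jointAcceptProbOn_eq_sum (F : QCircuitFamily cliffordT) (x : List Bool) (hN : 2 ≤ x.length + F.ancillas x.length) :
    F.jointAcceptProbOn 0 x = ∑ y : QReg (x.length + F.ancillas x.length),
      if (y ⟨1, hN⟩ = true ∧ y ⟨0, by omega⟩ = true) then
        ‖((F.circ x.length).mat *ᵥ basisState (padInput x.get (F.ancillas x.length))) y‖ ^ 2 else 0 := by
  classical
  rw [QCircuitFamily.jointAcceptProbOn, QCircuit.jointAcceptProb, QCircuit.probEvent, Finset.sum_filter]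
  refine Finset.sum_congr rfl fun y _ => ?_
  have h : y ∈ QCircuit.jointAcceptEvent (x.length + F.ancillas x.length) ↔ (y ⟨1, hN⟩ = true ∧ y ⟨0, by omega⟩ = true) :=
    ⟨fun ⟨_, hy0, hy1⟩ => ⟨hy1, hy0⟩, fun ⟨hy1, hy0⟩ => ⟨hN, hy0, hy1⟩⟩
  simp only [h]
  rfl

/-- If the post-selection probability is positive, the circuit has at least two wires.
[cite: Aaronson2005, Def. 1] -/
theorem two_le_of_postselectProbOn_pos (F : QCircuitFamily cliffordT) (x : List Bool) (h : 0 < F.postselectProbOn 0 x) :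
    2 ≤ x.length + F.ancillas x.length := by
  classical
  by_contra hN
  have hz : F.postselectProbOn 0 x = 0 := by
    rw [QCircuitFamily.postselectProbOn, QCircuit.postselectProb, QCircuit.probEvent]
    refine Finset.sum_eq_zero fun y hy => ?_
    rw [Finset.mem_filter] at hy
    obtain ⟨h1, -⟩ := hy.2
    omega
  rw [hz] at h
  exact lt_irrefl _ h

/-- Splitting a Born sum over an event by the value of one more wire. [folklore] -/
theorem sum_ite_eq_add_sum_ite_and {ι : Type*} [Fintype ι] (P : ι → Prop) [DecidablePred P] (g : ι → Bool) (f : ι → ℝ) :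
    (∑ i, if P i then f i else 0) = (∑ i, if (P i ∧ g i = true) then f i else 0) + ∑ i, if (P i ∧ g i = false) then f i else 0 := by
  rw [← Finset.sum_add_distrib]
  refine Finset.sum_congr rfl fun i _ => ?_
  by_cases hP : P i <;> cases g i <;> simp [hP]

/-! ### Transfer of the statistics (BJS Theorem 1, proof) -/

/-- **`Pr'[post] = 2^{-N s_f} · Pr[post]`**: the post-selection probability of the compiled family is
the constant of the simulation times that of the given oracle-free family (on every input on which the
latter post-selects with positive probability). [cite: BremnerJozsaShepherdPRSA2011, Thm. 1 (proof: "the same output conditional probabilities … now conditioned on the new extra post-selections too")] -/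
theorem postselectProbOn_eq (F : QCircuitFamily cliffordT) (hF : F.IsOracleFree) (x : List Bool)
    (hpos : 0 < F.postselectProbOn 0 x) :
    (gadgetFamily F).postselectProbOn x = gadgetConst (F.circ x.length) * F.postselectProbOn 0 x := by
  classical
  have hN := two_le_of_postselectProbOn_pos F x hpos
  rw [postselectProbOn_gadgetFamily F x hN, postselectProbOn_eq_sum F x hN,
    sum_ite_eq_add_sum_ite_and (PostZero (F.circ x.length)) (fun z => z (outWire (F.circ x.length))),
    sum_ite_eq_add_sum_ite_and (fun y : QReg (x.length + F.ancillas x.length) => y ⟨1, hN⟩ = true) (fun y => y ⟨0, by omega⟩),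
    mul_add, gadget_eventSum_eq (F.circ x.length) (hF _) hN x.get true, gadget_eventSum_eq (F.circ x.length) (hF _) hN x.get false]

/-- **`Pr'[acc ∧ post] = 2^{-N s_f} · Pr[acc ∧ post]`.** [cite: BremnerJozsaShepherdPRSA2011, Thm. 1 (proof)] -/
theorem jointAcceptProbOn_eq (F : QCircuitFamily cliffordT) (hF : F.IsOracleFree) (x : List Bool)
    (hpos : 0 < F.postselectProbOn 0 x) :
    (gadgetFamily F).jointAcceptProbOn x = gadgetConst (F.circ x.length) * F.jointAcceptProbOn 0 x := by
  classical
  have hN := two_le_of_postselectProbOn_pos F x hpos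
  rw [jointAcceptProbOn_gadgetFamily F x hN, jointAcceptProbOn_eq_sum F x hN,
    gadget_eventSum_eq (F.circ x.length) (hF _) hN x.get true]

/-- **The compiled family decides what the given family decides, with the same tolerance.** If a
uniform-or-not, oracle-free Clifford+T family post-decides `L` with tolerance `ε` in the sense of
`PostBQPWith ε` (conditional probabilities `≥ 1 - ε` / `≤ ε`, post-selection probability positive),
then `gadgetFamily F` post-decides `L` with tolerance `ε` in the sense of `PostIQPFamily.PostDecides`.
[cite: BremnerJozsaShepherdPRSA2011, Thm. 1 (proof, p. 7)] -/
theorem postDecides_gadgetFamily {ε : ℝ} {L : Language Bool} {F : QCircuitFamily cliffordT} (hF : F.IsOracleFree)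
    (h : ∀ x, 0 < F.postselectProbOn 0 x ∧
      (x ∈ L → 1 - ε ≤ F.condAcceptProbOn 0 x) ∧ (x ∉ L → F.condAcceptProbOn 0 x ≤ ε)) :
    (gadgetFamily F).PostDecides L ε := by
  intro x
  obtain ⟨hpos, hyes, hno⟩ := h x
  have hK := gadgetConst_pos (F.circ x.length)
  rw [postselectProbOn_eq F hF x hpos, jointAcceptProbOn_eq F hF x hpos]
  have hcond : F.condAcceptProbOn 0 x = F.jointAcceptProbOn 0 x / F.postselectProbOn 0 x := rfl
  refine ⟨mul_pos hK hpos, fun hx => ?_, fun hx => ?_⟩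
  · have h1 := hyes hx
    rw [hcond, le_div_iff₀ hpos] at h1
    nlinarith
  · have h1 := hno hx
    rw [hcond, div_le_iff₀ hpos] at h1
    nlinarith

/-- **BJS Theorem 1 (inclusion form) from the uniformity of the compiled family.** If the compiled
family of every uniform oracle-free Clifford+T family is uniform, then `PostBQPWith ε ⊆ PostIQPWith ε`
for every `ε`. [cite: BremnerJozsaShepherdPRSA2011, Thm. 1] -/
theorem PostBQPWith_subset_PostIQPWith_of_uniform
    (hU : ∀ F : QCircuitFamily cliffordT, F.IsOracleFree → F.IsUniform → (gadgetFamily F).IsUniform) :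
    PostBQPWith_subset_PostIQPWith := by
  rintro ε L ⟨F, hF, hFu, h⟩
  exact ⟨gadgetFamily F, hU F hF hFu, postDecides_gadgetFamily hF h⟩

end HGadget.Hop

end Literature.Computability.QuantumComplexity
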